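import Summits.BirchSwinnertonDyer.BirchSwinnertonDyer.Theorems.ClassRecordThreeCartanSupplySphericalLeaves
import HarnessLib

/-!
# The Hecke cut of (L1S) — §H.1–§H.3 and §H.5 of the `doublecoset` certificate for crux 24801 `CartanOnePlaceDegreeLawAtThree`

Lift-only port (cell bsd-stepL, SUMMON key `k5-lift1`, director-bsd (734)(1) CONCUR 2026-08-31) of §H.1–§H.3 (source lines 1644–1875) and §H.5 (1939–2017) of the crux-ideate workfile
`Summits/BirchSwinnertonDyer/BirchSwinnertonDyer/Cruxes/CartanOnePlaceDegreeLawAtThree/Lines/doublecoset.lean` (lineage `cruxidea-stmt-BirchSwinnertonDyer-24801-1`, generation 22,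
commit 721e9ccbdf4b, sha256-16 d3adee7328f6a76c, 2876 l.; farm rc 0, sorries 4 = its §4 stubs, none of which is lifted; referee landing record `VERDICT-DOUBLECOSET-G22-g88.md`).
Declarations, statements and proofs below are BYTE-IDENTICAL to the source; the only edits are the namespace (`…Cruxes.CartanOnePlaceDegreeLawAtThree.Doublecoset` ↦
`…Theorems.CartanDoubleCoset`, shared by the nine `ClassRecordThreeCartanSupply*` modules), the imports ∕ `open`s each module needs, and one-line docstrings added where the source
had none. Nothing is re-stated, weakened or re-proved.

CONTENT (generation 21, real proofs over the tree's cover datum `R : CoverReduction X q`). §H.1 the split sub-order `O_s = {y ∈ O₀' : red y diagonal}` exists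
(`exists_splitOrder`, the construction inside `CMRank.splitHeckeTransport`). §H.2 eigen-propagation along `ℂ[G]·u` for an endomorphism commuting with `G`
(`eigen_of_mem_spanG`, `eigen_of_mem_sup_spanG`). §H.3 FIX ⟹ DOCK: a `T`-fixed vector of the induced module IS the torus docking of its unit component once the double
coset `redHom(ι(O₀'¹))·T` is everything (`extendLevel`, `fixedForm`, `eq_dockTorus_of_fixed`, `dockTorus_zero`, `dockTorus_eq_smul_of_coe`), and for the diagonal torus it
is, by STRONG APPROXIMATION at the Cartan place (`Charext.strongApproxAtCartanPlace_holds`): `mem_torusCoset_split`. §H.5 (HF) ∧ (MO1) ⟹ (L1S)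
(`fixed_dependent_of_eigenModule`, `splitFixedRankOne_of_heckeFamily`). The leaves (HF) `CoverHeckeFamily` ∕ (MO1) `SplitLevelMultiplicityOne` of §H.4 are in
`…SphericalLeaves`.

HONEST: a `--supports stmt-BirchSwinnertonDyer-24801` helper module; it proves NOTHING about NUM ∕ NUM♮ (items 24801 ∕ 32276) or crux 19109 for any curve — the leaves (MO1)
`SplitLevelMultiplicityOne`, (BCV) `BorelCubicEigenDocking`, (VAN) `NonsplitTorusCubicVanishing`, (DS) ∧ (JLᶜ) stay OPEN; registry `Lines/petarea.lean` rev 8 untouched; BSD is proved for no curve.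
-/

set_option linter.dupNamespace false  -- `Summit.BirchSwinnertonDyer.BirchSwinnertonDyer.…` (summit = problem), as every file of this directory
set_option autoImplicit false

noncomputable section

open scoped Classical MatrixGroups
open Matrix

namespace Summit.BirchSwinnertonDyer.BirchSwinnertonDyer.Theorems.CartanDoubleCoset

open Summit.BirchSwinnertonDyer.BirchSwinnertonDyer.Theorems
open Summit.BirchSwinnertonDyer.BirchSwinnertonDyer.Theorems.CartanDegree (HasRatEigenvalue)
open Summit.BirchSwinnertonDyer.BirchSwinnertonDyer.Theorems.CartanTorusCubeCut (torusSubgroup mem_torusSubgroup lin linGL linGL_coe lin_comm torusSubgroup_isCyclic card_torusSubgroup)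
open Summit.BirchSwinnertonDyer.BirchSwinnertonDyer.Theorems.CartanCover (splitGen mem_splitTorus_iff)
open Summit.BirchSwinnertonDyer.BirchSwinnertonDyer.Theorems.CartanCover.Charext.InertHecke (upperUnip lowerUnip coe_upperUnip coe_lowerUnip upperUnip_mul upperUnip_zero exists_unip_factorization)
open scoped Pointwise ModularForm NumberField
open Module UpperHalfPlane
open Literature.NumberTheory.Automorphic WeierstrassCurve Literature.NumberTheory.EllipticCurves Literature.NumberTheory.EllipticCurves.ModularForms
open Literature.NumberTheory.EllipticCurves.Rank1Residual Summit.BirchSwinnertonDyer.Rank1Residual Literature.NumberTheory.GaloisRepresentations NumberField IsDedekindDomain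
open Summit.BirchSwinnertonDyer.BirchSwinnertonDyer.Theorems.CartanCover
open Summit.BirchSwinnertonDyer.BirchSwinnertonDyer.Theorems.CartanCover.CMRank
open Summit.BirchSwinnertonDyer.BirchSwinnertonDyer.Theorems.CartanTorusCubeCut
open Summit.BirchSwinnertonDyer.BirchSwinnertonDyer.Theorems.CartanDegree (cubicNewvectorChar HasRatEigenvalue)

/-! ## §H (NEW, generation 21): THE HECKE CUT OF (L1S) -/

section HeckeCut

variable {D M : ℕ} {C : Finset ℕ} {X : CartanLevelCurveData D M C} {q : ℕ} [Fact q.Prime]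

/-! ### §H.1 PROVED: the split sub-order `O_s = {y ∈ O₀' : red y diagonal}` exists (verbatim the construction inside `CMRank.splitHeckeTransport`) -/

/-- **The split sub-order.** `O_s := {y ∈ O₀' : R.red y` is diagonal`}` is an order of `X.B` presented by
`ι(O_s) = {ι y : y ∈ O₀', red y diagonal}` (the construction of `CMRank.splitHeckeTransport`, extracted). -/
theorem exists_splitOrder (R : CoverReduction X q) :
    ∃ (Os : Submodule ℤ X.B) (_ : Brandt.IsOrder X.B Os),
      ∀ m : Matrix (Fin 2) (Fin 2) ℝ, (∃ x ∈ Os, X.ι x = m) ↔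
        ∃ y : coverSubring X q, (R.red y) 0 1 = 0 ∧ (R.red y) 1 0 = 0 ∧ X.ι (y : X.B) = m := by
  have hqP : q.Prime := Fact.out
  let Os : Submodule ℤ X.B :=
    { carrier := {y | ∃ hy : y ∈ coverSubring X q, (R.red ⟨y, hy⟩) 0 1 = 0 ∧ (R.red ⟨y, hy⟩) 1 0 = 0}
      add_mem' := by
        rintro a b ⟨ha, ha1, ha2⟩ ⟨hb, hb1, hb2⟩
        refine ⟨add_mem ha hb, ?_, ?_⟩
        · have e : R.red ⟨a + b, add_mem ha hb⟩ = R.red ⟨a, ha⟩ + R.red ⟨b, hb⟩ := (map_add R.red ⟨a, ha⟩ ⟨b, hb⟩)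
          rw [e, Matrix.add_apply, ha1, hb1, add_zero]
        · have e : R.red ⟨a + b, add_mem ha hb⟩ = R.red ⟨a, ha⟩ + R.red ⟨b, hb⟩ := (map_add R.red ⟨a, ha⟩ ⟨b, hb⟩)
          rw [e, Matrix.add_apply, ha2, hb2, add_zero]
      zero_mem' := ⟨zero_mem _, by rw [show (⟨0, zero_mem _⟩ : coverSubring X q) = 0 from rfl, map_zero]; exact ⟨rfl, rfl⟩⟩
      smul_mem' := by
        rintro c a ⟨ha, ha1, ha2⟩
        refine ⟨(coverSubring X q).toAddSubgroup.zsmul_mem ha c, ?_⟩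
        have e : R.red ⟨c • a, (coverSubring X q).toAddSubgroup.zsmul_mem ha c⟩ = c • R.red ⟨a, ha⟩ :=
          map_zsmul R.red c ⟨a, ha⟩
        rw [e, Matrix.smul_apply, Matrix.smul_apply, ha1, ha2, smul_zero]
        exact ⟨rfl, rfl⟩ }
  have hOsmem : ∀ y : X.B, y ∈ Os ↔ ∃ hy : y ∈ coverSubring X q, (R.red ⟨y, hy⟩) 0 1 = 0 ∧ (R.red ⟨y, hy⟩) 1 0 = 0 :=
    fun y => Iff.rfl
  have hOsle : Os ≤ coverOrder X q := fun y hy => ((hOsmem y).mp hy).1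
  have hOs : Brandt.IsOrder X.B Os :=
    { one_mem := ⟨one_mem _, by
        rw [show (⟨1, one_mem _⟩ : coverSubring X q) = 1 from rfl, map_one]
        exact ⟨Matrix.one_apply_ne (by decide), Matrix.one_apply_ne (by decide)⟩⟩
      mul_mem := by
        rintro a ⟨ha, ha1, ha2⟩ b ⟨hb, hb1, hb2⟩
        refine ⟨mul_mem ha hb, ?_⟩
        have e : R.red ⟨a * b, mul_mem ha hb⟩ = R.red ⟨a, ha⟩ * R.red ⟨b, hb⟩ := map_mul R.red ⟨a, ha⟩ ⟨b, hb⟩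
        rw [e]
        constructor <;> simp [Matrix.mul_apply, Fin.sum_univ_two, ha1, ha2, hb1, hb2]
      isFullLattice := by
        refine isFullLattice_of_between (isOrder_coverOrder X q).isFullLattice hOsle (m := (q : ℤ))
          (by exact_mod_cast hqP.ne_zero) fun x hx => ?_
        refine ⟨(coverSubring X q).toAddSubgroup.zsmul_mem hx (q : ℤ), ?_⟩
        have e : R.red ⟨(q : ℤ) • x, (coverSubring X q).toAddSubgroup.zsmul_mem hx (q : ℤ)⟩ = (q : ℤ) • R.red ⟨x, hx⟩ :=
          map_zsmul R.red (q : ℤ) ⟨x, hx⟩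
        rw [e, Matrix.smul_apply, Matrix.smul_apply, zsmul_eq_mul, zsmul_eq_mul, Int.cast_natCast, ZMod.natCast_self,
          zero_mul, zero_mul]
        exact ⟨rfl, rfl⟩ }
  have hOsι : ∀ m : Matrix (Fin 2) (Fin 2) ℝ, (∃ x ∈ Os, X.ι x = m) ↔
      ∃ y : coverSubring X q, (R.red y) 0 1 = 0 ∧ (R.red y) 1 0 = 0 ∧ X.ι (y : X.B) = m := by
    intro m
    constructor
    · rintro ⟨x, ⟨hx, h1, h2⟩, hxm⟩
      exact ⟨⟨x, hx⟩, h1, h2, hxm⟩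
    · rintro ⟨y, h1, h2, hym⟩
      exact ⟨(y : X.B), ⟨y.2, h1, h2⟩, hym⟩
  exact ⟨Os, hOs, hOsι⟩

/-! ### §H.2 PROVED: eigen-propagation — an endomorphism commuting with `G` that scales `u` scales all of `ℂ[G]·u` (and sums of such spans) -/

/-- If `𝒯` commutes with the `G`-action `indRep` and `𝒯 u = a • u`, then `𝒯 w = a • w` on `ℂ[G]·u`. -/
theorem eigen_of_mem_spanG (R : CoverReduction X q) (𝒯 : R.IndCuspForm →ₗ[ℂ] R.IndCuspForm)
    (hcomm : ∀ (g : GL (Fin 2) (ZMod q)) (f : R.IndCuspForm), 𝒯 (R.indRep g f) = R.indRep g (𝒯 f))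
    {u : R.IndCuspForm} {a : ℂ} (hu : 𝒯 u = a • u) : ∀ w ∈ R.spanG u, 𝒯 w = a • w := by
  intro w hw
  change w ∈ Submodule.span ℂ (Set.range fun g : GL (Fin 2) (ZMod q) => R.indRep g u) at hw
  refine Submodule.span_induction (p := fun F _ => 𝒯 F = a • F) ?_ ?_ ?_ ?_ hw
  · rintro _ ⟨g, rfl⟩
    rw [hcomm, hu, map_smul]
  · simp
  · intro x y _ _ hx hy
    rw [map_add, hx, hy, smul_add]
  · intro c x _ hx
    rw [map_smul, hx, smul_comm]

/-- The same on `ℂ[G]·u + ℂ[G]·v` for two `a`-eigenvectors `u`, `v`. -/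
theorem eigen_of_mem_sup_spanG (R : CoverReduction X q) (𝒯 : R.IndCuspForm →ₗ[ℂ] R.IndCuspForm)
    (hcomm : ∀ (g : GL (Fin 2) (ZMod q)) (f : R.IndCuspForm), 𝒯 (R.indRep g f) = R.indRep g (𝒯 f))
    {u v : R.IndCuspForm} {a : ℂ} (hu : 𝒯 u = a • u) (hv : 𝒯 v = a • v) :
    ∀ w ∈ R.spanG u ⊔ R.spanG v, 𝒯 w = a • w := by
  intro w hw
  obtain ⟨x, hx, y, hy, rfl⟩ := Submodule.mem_sup.mp hw
  rw [map_add, eigen_of_mem_spanG R 𝒯 hcomm hu x hx, eigen_of_mem_spanG R 𝒯 hcomm hv y hy, smul_add]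

/-! ### §H.3 PROVED: FIX ⟹ DOCK — a `T`-fixed vector of the induced module IS a torus docking, once the double coset `redHom(ι(O₀'¹))·T` is everything
(for the diagonal torus `T_s` this is STRONG APPROXIMATION at the Cartan place, the tree theorem `Charext.strongApproxAtCartanPlace_holds`) -/

/-- `Γ̄(q)` has finite (non-zero) index in `ι(O₀'¹)`: it is the kernel of `redHom` into the finite group `GL₂(𝔽_q)`. -/
theorem relIndex_principalLevel_coverUnits_ne_zero (R : CoverReduction X q) :
    (principalLevel X q).relIndex (coverUnits X q) ≠ 0 := by
  have hker : (principalLevel X q).subgroupOf (coverUnits X q) = R.redHom.ker := by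
    ext γ
    rw [Subgroup.mem_subgroupOf, MonoidHom.mem_ker, R.mem_ker_redHom_iff]
  rw [Subgroup.relIndex, hker, Subgroup.index_ker]
  haveI : Finite (R.redHom.range) := inferInstance
  exact Nat.card_pos.ne'

/-- Hence `Γ̄(q)` has non-zero index in every `Γ_T`. -/
theorem relIndex_principalLevel_levelOf_ne_zero (R : CoverReduction X q) (T : Subgroup (GL (Fin 2) (ZMod q))) :
    (principalLevel X q).relIndex (R.levelOf T) ≠ 0 :=
  fun h0 => relIndex_principalLevel_coverUnits_ne_zero R (Subgroup.relIndex_eq_zero_of_le_right (R.levelOf_le T) h0)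

/-- **Level extension.** A `Γ̄(q)`-cusp form fixed by `ρ(γ)` for every `γ ∈ ι(O₀'¹)` reducing into `T` IS a cusp form of level `Γ_T = redHom⁻¹(T)`
(same function; cusp condition transported along the finite-index inclusion `Γ̄(q) ≤ Γ_T`). -/
def extendLevel (R : CoverReduction X q) (T : Subgroup (GL (Fin 2) (ZMod q))) (F₀ : CuspForm (principalLevel X q) 2)
    (hF₀ : ∀ γ : coverUnits X q, R.redHom γ ∈ T → coverRep X q γ F₀ = F₀) : CuspForm (R.levelOf T) 2 where
  toFun := F₀
  slash_action_eq' A hA := by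
    obtain ⟨hAc, hAT⟩ := (R.mem_levelOf_iff T).mp hA
    have hinvT : R.redHom (⟨A, hAc⟩⁻¹) ∈ T := by
      rw [map_inv]
      exact T.inv_mem hAT
    have h := congrArg (fun G : CuspForm (principalLevel X q) 2 => (⇑G : ℍ → ℂ)) (hF₀ _ hinvT)
    simpa [coverRep_apply, coe_coverSlash] using h
  holo' := F₀.holo'
  zero_at_cusps' hc := F₀.zero_at_cusps'
    ((isCusp_iff_of_relIndex_ne_zero (R.principalLevel_le_levelOf T) (relIndex_principalLevel_levelOf_ne_zero R T) _).mpr hc)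

/-- `extendLevel` does not change the underlying function. -/
@[simp] theorem coe_extendLevel (R : CoverReduction X q) (T : Subgroup (GL (Fin 2) (ZMod q))) (F₀ : CuspForm (principalLevel X q) 2)
    (hF₀ : ∀ γ : coverUnits X q, R.redHom γ ∈ T → coverRep X q γ F₀ = F₀) : ⇑(extendLevel R T F₀ hF₀) = ⇑F₀ := rfl

/-- restricting the extended form back to `Γ̄(q)` recovers `F₀`. -/
theorem restrictLevel_extendLevel (R : CoverReduction X q) (T : Subgroup (GL (Fin 2) (ZMod q))) (F₀ : CuspForm (principalLevel X q) 2)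
    (hF₀ : ∀ γ : coverUnits X q, R.redHom γ ∈ T → coverRep X q γ F₀ = F₀) : R.restrictLevel T (extendLevel R T F₀ hF₀) = F₀ := by
  apply CuspForm.ext
  intro τ
  rfl

/-- The unit component of a `T`-fixed vector of the induced module is `ρ(γ)`-fixed for every `γ` reducing into `T`. -/
theorem coverRep_apply_one_of_fixed (R : CoverReduction X q) {T : Subgroup (GL (Fin 2) (ZMod q))} (f : R.IndCuspForm)
    (hfix : ∀ t ∈ T, R.indRep t f = f) (γ : coverUnits X q) (hγ : R.redHom γ ∈ T) : coverRep X q γ (f.1 1) = f.1 1 := by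
  have h1 : f.1 (R.redHom γ * 1) = coverRep X q γ (f.1 1) := f.2 γ 1
  have h2 := congrArg (fun F : R.IndCuspForm => F.1 1) (hfix _ hγ)
  simp only [CoverReduction.indRep_apply, one_mul] at h2
  rw [mul_one] at h1
  rw [← h1, h2]

/-- **The fixed vector's form**: the unit component of a `T`-fixed `f`, as a cusp form of level `Γ_T`. -/
def fixedForm (R : CoverReduction X q) (T : Subgroup (GL (Fin 2) (ZMod q))) (f : R.IndCuspForm) (hfix : ∀ t ∈ T, R.indRep t f = f) :
    CuspForm (R.levelOf T) 2 :=
  extendLevel R T (f.1 1) (fun γ hγ => coverRep_apply_one_of_fixed R f hfix γ hγ)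

/-- the underlying function of `fixedForm` is that of the unit component. -/
@[simp] theorem coe_fixedForm (R : CoverReduction X q) (T : Subgroup (GL (Fin 2) (ZMod q))) (f : R.IndCuspForm)
    (hfix : ∀ t ∈ T, R.indRep t f = f) : ⇑(fixedForm R T f hfix) = ⇑(f.1 1) := rfl

/-- restricting `fixedForm` to `Γ̄(q)` gives back the unit component. -/
theorem restrictLevel_fixedForm (R : CoverReduction X q) (T : Subgroup (GL (Fin 2) (ZMod q))) (f : R.IndCuspForm)
    (hfix : ∀ t ∈ T, R.indRep t f = f) : R.restrictLevel T (fixedForm R T f hfix) = f.1 1 :=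
  restrictLevel_extendLevel R T _ _

/-- **FIX ⟹ DOCK.** If the double coset `redHom(ι(O₀'¹))·T` is all of `GL₂(𝔽_q)`, every `T`-fixed vector of the induced module is the torus docking of its
own unit component. -/
theorem eq_dockTorus_of_fixed (R : CoverReduction X q) (T : Subgroup (GL (Fin 2) (ZMod q))) (hT : ∀ g, g ∈ R.torusCoset T)
    (f : R.IndCuspForm) (hfix : ∀ t ∈ T, R.indRep t f = f) : f = R.dockTorus T (fixedForm R T f hfix) := by
  apply Subtype.ext
  funext g
  obtain ⟨γ, hγ⟩ := hT g
  rw [R.dockTorus_apply_of_witness T _ hγ, restrictLevel_fixedForm]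
  have h1 : f.1 g = coverRep X q γ (f.1 ((R.redHom γ)⁻¹ * g)) := by
    have := f.2 γ ((R.redHom γ)⁻¹ * g)
    rwa [mul_inv_cancel_left] at this
  have h2 : f.1 ((R.redHom γ)⁻¹ * g) = f.1 1 := by
    have := congrArg (fun F : R.IndCuspForm => F.1 1) (hfix _ hγ)
    simpa only [CoverReduction.indRep_apply, one_mul] using this
  rw [h1, h2]

/-- The docking of the zero form is zero. -/
theorem dockTorus_zero (R : CoverReduction X q) (T : Subgroup (GL (Fin 2) (ZMod q))) : R.dockTorus T 0 = 0 := by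
  apply Subtype.ext
  funext g
  by_cases hg : g ∈ R.torusCoset T
  · obtain ⟨γ, hγ⟩ := hg
    rw [R.dockTorus_apply_of_witness T _ hγ]
    have h0 : R.restrictLevel T (0 : CuspForm (R.levelOf T) 2) = 0 := by
      apply CuspForm.ext; intro τ; rfl
    rw [h0, map_zero]
    rfl
  · rw [R.dockTorus_apply_of_not T _ hg]
    rfl

/-- Docking is homogeneous on the underlying functions: `⇑G = c • ⇑F ⟹ dockTorus G = c • dockTorus F`. -/
theorem dockTorus_eq_smul_of_coe (R : CoverReduction X q) (T : Subgroup (GL (Fin 2) (ZMod q))) {F G : CuspForm (R.levelOf T) 2} {c : ℂ}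
    (h : (⇑G : ℍ → ℂ) = c • ⇑F) : R.dockTorus T G = c • R.dockTorus T F := by
  have hres : R.restrictLevel T G = c • R.restrictLevel T F := by
    apply CuspForm.ext
    intro τ
    have := congr_fun h τ
    simpa [CoverReduction.coe_restrictLevel] using this
  apply Subtype.ext
  funext g
  rw [R.smul_apply_component]
  by_cases hg : g ∈ R.torusCoset T
  · obtain ⟨γ, hγ⟩ := hg
    rw [R.dockTorus_apply_of_witness T G hγ, R.dockTorus_apply_of_witness T F hγ, hres, map_smul]
  · rw [R.dockTorus_apply_of_not T G hg, R.dockTorus_apply_of_not T F hg, smul_zero]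

/-- **STRONG APPROXIMATION ⟹ the diagonal torus sees every sheet**: `redHom(ι(O₀'¹))·T_s = GL₂(𝔽_q)` (`det : T_s ↠ 𝔽_q^×` and `SL₂(𝔽_q) ≤ redHom(ι(O₀'¹))`). -/
theorem mem_torusCoset_split (R : CoverReduction X q) (hq : q ∈ C) (g : GL (Fin 2) (ZMod q)) :
    g ∈ R.torusCoset (CartanTorusCubeCut.torusSubgroup (splitGen q)) := by
  have hqP : q.Prime := Fact.out
  -- the diagonal correction `t = diag(det g, 1) ∈ T_s`
  set d : ZMod q := Matrix.det (g : Matrix (Fin 2) (Fin 2) (ZMod q)) with hd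
  have hd0 : d ≠ 0 := by
    rw [hd, ← Matrix.GeneralLinearGroup.val_det_apply]
    exact (Matrix.GeneralLinearGroup.det g).ne_zero
  have hdet_t : Matrix.det !![d, 0; 0, (1 : ZMod q)] ≠ 0 := by
    rw [Matrix.det_fin_two_of]; simpa using hd0
  let t : GL (Fin 2) (ZMod q) := Matrix.GeneralLinearGroup.mkOfDetNeZero _ hdet_t
  have ht_coe : (t : Matrix (Fin 2) (Fin 2) (ZMod q)) = !![d, 0; 0, 1] := rfl
  have ht : t ∈ CartanTorusCubeCut.torusSubgroup (splitGen q) := by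
    rw [mem_splitTorus_iff]
    refine ⟨?_, ?_⟩
    · show (t : Matrix (Fin 2) (Fin 2) (ZMod q)) 0 1 = 0
      rw [ht_coe]; rfl
    · show (t : Matrix (Fin 2) (Fin 2) (ZMod q)) 1 0 = 0
      rw [ht_coe]; rfl
  have hdet1 : Matrix.det ((g * t⁻¹ : GL (Fin 2) (ZMod q)) : Matrix (Fin 2) (Fin 2) (ZMod q)) = 1 := by
    have hdt : Matrix.det (t : Matrix (Fin 2) (Fin 2) (ZMod q)) = d := by
      rw [ht_coe, Matrix.det_fin_two_of]; ring
    have hti : Matrix.det ((t⁻¹ : GL (Fin 2) (ZMod q)) : Matrix (Fin 2) (Fin 2) (ZMod q)) * d = 1 := by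
      rw [← hdt, ← Matrix.det_mul, ← Matrix.GeneralLinearGroup.coe_mul, inv_mul_cancel, Matrix.GeneralLinearGroup.coe_one, Matrix.det_one]
    rw [Matrix.GeneralLinearGroup.coe_mul, Matrix.det_mul, ← hd]
    rw [mul_comm] at hti
    exact hti
  obtain ⟨γ, hγ⟩ := Charext.strongApproxAtCartanPlace_holds D M C X q hq R (g * t⁻¹) hdet1
  refine (R.mem_torusCoset_iff _ g).mpr ⟨γ, ?_⟩
  rw [hγ, _root_.mul_inv_rev, inv_inv, mul_assoc, inv_mul_cancel, mul_one]
  exact ht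

/-! ### §H.5 PROVED: (HF) ∧ (MO1) ⟹ (L1S) -/

/-- **The core of the cut**: inside a `G`-module on which every good `𝒯 ℓ` acts by `a_ℓ(V)`, two `T_s`-fixed vectors are dependent — they are torus dockings
(FIX ⟹ DOCK by strong approximation) of `T_ℓ^{O_s}`-eigenforms with the eigenvalues of `V` ((HF)(iii)), and (MO1) makes those proportional. -/
theorem fixed_dependent_of_eigenModule {V : WeierstrassCurve ℚ} [V.IsElliptic] (hMO : SplitLevelMultiplicityOne)
    {N : ℕ} (hq : q ∈ C) (R : CoverReduction X q) (hN : V.conductorNorm ℤ = N) (hDMC : D * M * ∏ p ∈ C, p ^ 2 = N)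
    (Os : Submodule ℤ X.B) (hOs : Brandt.IsOrder X.B Os)
    (hpres : ∀ m : Matrix (Fin 2) (Fin 2) ℝ, (∃ x ∈ Os, X.ι x = m) ↔
      ∃ y : coverSubring X q, (R.red y) 0 1 = 0 ∧ (R.red y) 1 0 = 0 ∧ X.ι (y : X.B) = m)
    (𝒯 : ℕ → (R.IndCuspForm →ₗ[ℂ] R.IndCuspForm))
    (hiii : ∀ ℓ : ℕ, ℓ.Prime → ¬ ℓ ∣ q * (D * M * ∏ p ∈ C, p) →
        ∀ (F : CuspForm (R.levelOf (CartanTorusCubeCut.torusSubgroup (splitGen q))) 2) (a : ℂ),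
          (unitsHeckeFun X.ι hOs ℓ (⇑F) = fun τ => a * F τ) ↔
            𝒯 ℓ (R.dockTorus (CartanTorusCubeCut.torusSubgroup (splitGen q)) F) =
              a • R.dockTorus (CartanTorusCubeCut.torusSubgroup (splitGen q)) F)
    (𝓜 : Submodule ℂ R.IndCuspForm)
    (h𝓜 : ∀ ℓ : ℕ, ℓ.Prime → ¬ ℓ ∣ q * (D * M * ∏ p ∈ C, p) → ∀ w ∈ 𝓜, 𝒯 ℓ w = (((V.LFunction ℓ : ℤ)) : ℂ) • w) :
    ∀ w₁ ∈ 𝓜, ∀ w₂ ∈ 𝓜,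
      (∀ t ∈ CartanTorusCubeCut.torusSubgroup (splitGen q), R.indRep t w₁ = w₁) →
      (∀ t ∈ CartanTorusCubeCut.torusSubgroup (splitGen q), R.indRep t w₂ = w₂) →
      w₁ ≠ 0 → ∃ c : ℂ, w₂ = c • w₁ := by
  intro w₁ hw₁ w₂ hw₂ hfix₁ hfix₂ hne
  set T := CartanTorusCubeCut.torusSubgroup (splitGen q) with hT
  have hfull : ∀ g, g ∈ R.torusCoset T := mem_torusCoset_split R hq
  -- the two fixed vectors are dockings of their unit components
  set F₁ := fixedForm R T w₁ hfix₁ with hF₁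
  set F₂ := fixedForm R T w₂ hfix₂ with hF₂
  have hd₁ : w₁ = R.dockTorus T F₁ := eq_dockTorus_of_fixed R T hfull w₁ hfix₁
  have hd₂ : w₂ = R.dockTorus T F₂ := eq_dockTorus_of_fixed R T hfull w₂ hfix₂
  -- both are `T_ℓ^{O_s}`-eigen with the eigenvalues of `V`
  have hE₁ : ∀ ℓ : ℕ, ℓ.Prime → ¬ ℓ ∣ q * (D * M * ∏ p ∈ C, p) →
      unitsHeckeFun X.ι hOs ℓ (⇑F₁) = fun τ => ((V.LFunction ℓ : ℤ) : ℂ) * F₁ τ := by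
    intro ℓ hℓ hnd
    apply (hiii ℓ hℓ hnd F₁ _).mpr
    rw [← hd₁]
    exact h𝓜 ℓ hℓ hnd w₁ hw₁
  have hE₂ : ∀ ℓ : ℕ, ℓ.Prime → ¬ ℓ ∣ q * (D * M * ∏ p ∈ C, p) →
      unitsHeckeFun X.ι hOs ℓ (⇑F₂) = fun τ => ((V.LFunction ℓ : ℤ) : ℂ) * F₂ τ := by
    intro ℓ hℓ hnd
    apply (hiii ℓ hℓ hnd F₂ _).mpr
    rw [← hd₂]
    exact h𝓜 ℓ hℓ hnd w₂ hw₂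
  have hF₁0 : F₁ ≠ 0 := by
    intro h0
    apply hne
    rw [hd₁, h0, dockTorus_zero]
  obtain ⟨c, hc⟩ := hMO V N D M C q X hq R hN hDMC Os hOs hpres F₁ F₂ hE₁ hE₂ hF₁0
  refine ⟨c, ?_⟩
  rw [hd₂, hd₁]
  exact dockTorus_eq_smul_of_coe R T hc

/-- **(HF) ∧ (MO1) ⟹ (L1S)** — generation 18's hardest stub is CUT into a structural Hecke-family statement and classical split-level multiplicity one. -/
theorem splitFixedRankOne_of_heckeFamily (hHF : CoverHeckeFamily) (hMO : SplitLevelMultiplicityOne) : SplitFixedRankOne := by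
  intro V _ _ _ N D M C q _ X W₁ _ Q hq R hN hDMC _ _ _ hQ
  have hLV : V.LFunction = W₁.LFunction := LFunction_eq_of_isIsogenous_holds V W₁ hQ.1
  -- eigen-equations of the class-minimal form, in the currency of `V`
  have hQe : ∀ ℓ : ℕ, ℓ.Prime → ¬ ℓ ∣ D * M * ∏ p ∈ C, p →
      X.heckeFun ℓ Q.form = fun τ => ((V.LFunction ℓ : ℤ) : ℂ) * Q.form τ := by
    intro ℓ hℓ hnd
    rw [hLV]
    exact Q.hecke_eq ℓ hℓ hnd
  have hgood : ∀ ℓ : ℕ, ¬ ℓ ∣ q * (D * M * ∏ p ∈ C, p) → ¬ ℓ ∣ D * M * ∏ p ∈ C, p :=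
    fun ℓ h h' => h (dvd_mul_of_dvd_right h' q)
  refine ⟨?_, ?_⟩
  · -- (a): the partner is a good-Hecke `V`-eigenform of `S₂(X.Gamma)`, docked on the non-split side
    intro F hF
    obtain ⟨Os, hOs, hpres⟩ := exists_splitOrder R
    obtain ⟨𝒯, hcomm, hii, hiii⟩ := hHF D M C X q hq R Os hOs hpres
    refine fixed_dependent_of_eigenModule hMO hq R hN hDMC Os hOs hpres 𝒯 hiii _ ?_
    intro ℓ hℓ hnd
    exact eigen_of_mem_sup_spanG R (𝒯 ℓ) (hcomm ℓ) (hii ℓ hℓ hnd Q.form _ (hQe ℓ hℓ (hgood ℓ hnd)))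
      (hii ℓ hℓ hnd F _ (hF ℓ hℓ (hgood ℓ hnd)))
  · -- (b): the partner is a `T_ℓ^{O_s}`-eigenform of split-Cartan level, docked on the torus
    intro Os hOs hpres F hF
    obtain ⟨𝒯, hcomm, hii, hiii⟩ := hHF D M C X q hq R Os hOs hpres
    refine fixed_dependent_of_eigenModule hMO hq R hN hDMC Os hOs hpres 𝒯 hiii _ ?_
    intro ℓ hℓ hnd
    exact eigen_of_mem_sup_spanG R (𝒯 ℓ) (hcomm ℓ) (hii ℓ hℓ hnd Q.form _ (hQe ℓ hℓ (hgood ℓ hnd)))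
      ((hiii ℓ hℓ hnd F _).mp (hF ℓ hℓ hnd))

end HeckeCut

end Summit.BirchSwinnertonDyer.BirchSwinnertonDyer.Theorems.CartanDoubleCoset

end
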